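import Mathlib
import HarnessLib
import Summits.HubbardSuperconductivity.HubbardSuperconductivity.Theorems.ChiralWindowCwKLChiralWindowBlockNodeR
import Summits.HubbardSuperconductivity.HubbardSuperconductivity.Theorems.ChiralWindowCwKLChiralWindowBlockBoundsR
import Summits.HubbardSuperconductivity.HubbardSuperconductivity.Theorems.ChiralWindowCwKLChiralWindowCoverLogicR
import Summits.HubbardSuperconductivity.HubbardSuperconductivity.Theorems.ChiralWindowCwKLChiralWindowCertNumerical
import Summits.HubbardSuperconductivity.HubbardSuperconductivity.Theorems.ChiralWindowCwKLChiralWindowRotPartner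
import Summits.HubbardSuperconductivity.HubbardSuperconductivity.Theorems.ChiralWindowCwKLChiralWindowLindhardD4
import Literature.MathematicalPhysics.QuantumLattice.KohnLuttingerFermiCurvePolar

/-!
# Crux `CwKLChiralWindow` (stmt-1741), line `Sketch`: soundness of the certificate, RESIDUAL FORM (`stub_klCertNumericalR`)

If the kernel-decidable checker accepts a record `c : KLCert` (`c.checkR = true`) and the record's enclosures hold
(`c.EnclosuresR`, interface E0, E1, E2, E3R, E4, E5, E6 — residual form, `Theorems/ChiralWindowDefsResidual.lean`), then the `μ`-form numerical clauses N0–N5 hold on the record's window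
`[c.mub, c.mua]` with margin `c.gamma` and node-covering constant `c.cov`.  Assembly of the landed block-level
soundness theorems (`stub_klBlockBoundsR`: `lowerR ≤ channelInf ≤ upper`; `stub_klBlockNodeR`: pointwise amplitude
bounds for bottom states) with the combinatorics of the checker (`stub_klCoverLogicR`): on the box containing `μ`
the Boolean tests `isolationOKR` / `b1gLeadsOKR` / `eLeadsOKR` become real inequalities between channel bottoms, and
`nodeOKR` + the node enclosures give `cov ≤ g² + f² + (f∘rot)²` a.e. by the Kato-type arithmetic `klc_node_arith`.
The analytic helpers `klc_ae_mem_fermiCurve`, `klc_rot3_bridge`, `klc_node_arith` are reused from the α-form file.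
-/

noncomputable section

set_option linter.dupNamespace false

namespace Summit.HubbardSuperconductivity.HubbardSuperconductivity.Theorems

open MeasureTheory Literature.MathematicalPhysics.QuantumLattice CwKLChiralWindow

/-- What `templeOKR` says about the trial's norm enclosure: the trial is used and `0 < Nlo ≤ Nhi`. [folklore] -/
theorem klcr_of_templeOKR {b : KLBlock} {tab : List KLTrig} {χ : D4Irrep} (hT : b.templeOKR tab χ = true) :
    b.useTrial = true ∧ 0 < b.Nlo ∧ b.Nlo ≤ b.Nhi := by
  have hT' := hT
  simp only [KLBlock.templeOKR, KLBlock.ritzOK, Bool.and_eq_true, decide_eq_true_eq] at hT'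
  obtain ⟨⟨⟨⟨⟨⟨⟨⟨⟨⟨⟨⟨hut, -⟩, -⟩, hNlo⟩, hNN⟩, -⟩, -⟩, -⟩, -⟩, -⟩, -⟩, -⟩, -⟩ := hT'
  exact ⟨hut, hNlo, hNN⟩

/-- What `basicOK` says, as a flat conjunction. [folklore] -/
theorem klcr_of_basicOKR {bx : KLBox} {tab : List KLTrig} (h : bx.basicOKR tab = true) :
    -4 < bx.mulo ∧ bx.mulo ≤ bx.muhi ∧ bx.muhi < 0 ∧ bx.bB1g.ritzOK tab .B1g = true ∧ bx.bE.ritzOK tab .E = true ∧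
      bx.bB1g.withU = false ∧ bx.bE.withU = false ∧ bx.bA1g.lowerOKR tab .A1g = true ∧
      bx.bA2g.lowerOKR tab .A2g = true ∧ bx.bB1g.lowerOKR tab .B1g = true ∧ bx.bB2g.lowerOKR tab .B2g = true ∧
      bx.bE.lowerOKR tab .E = true := by
  simpa only [KLBox.basicOKR, Bool.and_eq_true, decide_eq_true_eq, Bool.not_eq_true', and_assoc] using h

/-- What `nodeOK` says, as a flat conjunction. [folklore] -/
theorem klcr_of_nodeOKR {bx : KLBox} {tab : List KLTrig} {cov : ℚ} (h : bx.nodeOKR tab cov = true) :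
    bx.bB1g.useTrial = true ∧ bx.bE.useTrial = true ∧ bx.bB1g.templeOKR tab .B1g = true ∧ bx.bE.templeOKR tab .E = true ∧
      bx.bB1g.Hhi < 2 * bx.bB1g.rhohi ^ 2 ∧ bx.bE.Hhi < 3 * bx.bE.rhohi ^ 2 ∧
      0 ≤ bx.R2 ∧ 0 < bx.pB ∧ 0 < bx.pE ∧ 0 ≤ bx.bB1g.katoR ∧ 0 ≤ bx.bE.katoR ∧
      0 ≤ bx.r1B ∧ bx.R2 * bx.bB1g.katoR ≤ bx.r1B ^ 2 ∧ 0 ≤ bx.r2B ∧ bx.r2B ^ 2 * bx.bB1g.Nhi ≤ bx.pB ∧ bx.r1B < bx.r2B ∧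
      0 ≤ bx.r1E ∧ bx.R2 * bx.bE.katoR ≤ bx.r1E ^ 2 ∧ 0 ≤ bx.r2E ∧ bx.r2E ^ 2 * bx.bE.Nhi ≤ bx.pE ∧ bx.r1E < bx.r2E ∧
      cov * (bx.bB1g.lowerR tab .B1g) ^ 2 ≤ (bx.r2B - bx.r1B) ^ 2 ∧
      cov * (bx.bE.lowerR tab .E) ^ 2 ≤ (bx.r2E - bx.r1E) ^ 2 := by
  simpa only [KLBox.nodeOKR, Bool.and_eq_true, decide_eq_true_eq, and_assoc] using h

/-- **Bounds on a box.** On a box passing `basicOK` and `nodeOK`, at a level `μ` of the box where the block enclosures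
hold: `μ ∈ (-4,0)`, `lower_χ ≤ channelInf ε₀ μ 1 χ` for all five channels, and `channelInf ≤ upper` for `B1g` and `E`.
[folklore] -/
theorem klcr_box_bounds {μ : ℝ} (bx : KLBox) (tab : List KLTrig) {cov : ℚ}
    (hb : bx.basicOKR tab = true) (hn : bx.nodeOKR tab cov = true)
    (hμ : μ ∈ Set.Icc ((bx.mulo : ℚ) : ℝ) ((bx.muhi : ℚ) : ℝ))
    (hE : ∀ χ : D4Irrep, (bx.blk χ).EnclosureR tab μ χ) :
    μ ∈ Set.Ioo (-4 : ℝ) 0 ∧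
    (∀ χ : D4Irrep, (((bx.blk χ).lowerR tab χ : ℚ) : ℝ) ≤ channelInf (squareDispersion 1 0) μ 1 χ) ∧
    channelInf (squareDispersion 1 0) μ 1 D4Irrep.B1g ≤ ((bx.bB1g.upper : ℚ) : ℝ) ∧
    channelInf (squareDispersion 1 0) μ 1 D4Irrep.E ≤ ((bx.bE.upper : ℚ) : ℝ) := by
  obtain ⟨h4, -, h0, -, -, hwB, hwE, hlA1, hlA2, hlB1, hlB2, hlE⟩ := klcr_of_basicOKR hb
  obtain ⟨-, -, htB, htE, -⟩ := klcr_of_nodeOKR hn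
  have h4' : (-4 : ℝ) < ((bx.mulo : ℚ) : ℝ) := by exact_mod_cast h4
  have h0' : ((bx.muhi : ℚ) : ℝ) < 0 := by exact_mod_cast h0
  have hμ' : μ ∈ Set.Ioo (-4 : ℝ) 0 := ⟨h4'.trans_le hμ.1, hμ.2.trans_lt h0'⟩
  have hlow : ∀ χ : D4Irrep, (bx.blk χ).lowerOKR tab χ = true := by
    intro χ
    cases χ
    · exact hlA1
    · exact hlA2
    · exact hlB1
    · exact hlB2
    · exact hlE
  refine ⟨hμ', fun χ => (stub_klBlockBoundsR μ hμ' (bx.blk χ) tab χ (hE χ)).1 (hlow χ), ?_, ?_⟩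
  · exact (stub_klBlockBoundsR μ hμ' bx.bB1g tab D4Irrep.B1g (hE D4Irrep.B1g)).2 htB (Or.inr (by decide))
  · exact (stub_klBlockBoundsR μ hμ' bx.bE tab D4Irrep.E (hE D4Irrep.E)).2 htE (Or.inr (by decide))

set_option maxHeartbeats 400000 in
/-- **Node covering on a box.** On a box passing `basicOK` and `nodeOK`, at a level `μ` of the box where the block
enclosures and the node enclosures hold, every `B1g` bottom state `g` and every `E` bottom state `f` satisfy
`cov ≤ g² + f² + (f∘rot)²` a.e. [folklore] -/
theorem klcr_box_node {μ : ℝ} (bx : KLBox) (tab : List KLTrig) {cov : ℚ}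
    (hb : bx.basicOKR tab = true) (hn : bx.nodeOKR tab cov = true)
    (hμ : μ ∈ Set.Icc ((bx.mulo : ℚ) : ℝ) ((bx.muhi : ℚ) : ℝ))
    (hE : ∀ χ : D4Irrep, (bx.blk χ).EnclosureR tab μ χ) (hN : bx.NodeEnclosure tab μ)
    (g f : Momentum → ℝ)
    (hg : IsChannelState (squareDispersion 1 0) μ D4Irrep.B1g g)
    (hgv : pairingForm (squareDispersion 1 0) μ 1 g = channelInf (squareDispersion 1 0) μ 1 D4Irrep.B1g)
    (hf : IsChannelState (squareDispersion 1 0) μ D4Irrep.E f)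
    (hfv : pairingForm (squareDispersion 1 0) μ 1 f = channelInf (squareDispersion 1 0) μ 1 D4Irrep.E) :
    ∀ᵐ k ∂fermiCurveMeasure (squareDispersion 1 0) μ, ((cov : ℚ) : ℝ) ≤ g k ^ 2 + (f k ^ 2 + f (rotMomentum k) ^ 2) := by
  obtain ⟨hμ', -, -, -⟩ := klcr_box_bounds bx tab hb hn hμ hE
  obtain ⟨-, -, -, -, -, hwB, hwE, -⟩ := klcr_of_basicOKR hb
  obtain ⟨-, -, htB, htE, hmB, hmE, hR2, -, -, -, -, hr1B, hr1Be, hr2B, hr2Bp, hr12B, hr1E, hr1Ee, hr2E, hr2Ep, hr12E,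
    hcB, hcE⟩ := klcr_of_nodeOKR hn
  obtain ⟨hutB, hNloB, hNNB⟩ := klcr_of_templeOKR htB
  obtain ⟨hutE, hNloE, hNNE⟩ := klcr_of_templeOKR htE
  have hEB : bx.bB1g.EnclosureR tab μ D4Irrep.B1g := hE D4Irrep.B1g
  have hEE : bx.bE.EnclosureR tab μ D4Irrep.E := hE D4Irrep.E
  obtain ⟨-, hNB, -⟩ := hEB.1 hutB
  obtain ⟨-, hNE, -⟩ := hEE.1 hutE
  have hNhiB : (0 : ℝ) < ((bx.bB1g.Nhi : ℚ) : ℝ) := by exact_mod_cast hNloB.trans_le hNNB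
  have hNhiE : (0 : ℝ) < ((bx.bE.Nhi : ℚ) : ℝ) := by exact_mod_cast hNloE.trans_le hNNE
  have hF := klc_ae_mem_fermiCurve hμ'
  have hrow : ∀ᵐ k ∂fermiCurveMeasure (squareDispersion 1 0) μ,
      ∫ k', lindhardFunction (squareDispersion 1 0) μ (k + k') ^ 2 ∂fermiCurveMeasure (squareDispersion 1 0) μ ≤
        ((bx.R2 : ℚ) : ℝ) := hF.mono fun k hk => (hN k hk).1
  have hR2' : (0 : ℝ) ≤ ((bx.R2 : ℚ) : ℝ) := by exact_mod_cast hR2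
  have hmB' : ((bx.bB1g.Hhi : ℚ) : ℝ) < (if D4Irrep.B1g = D4Irrep.E then 3 else 2) * ((bx.bB1g.rhohi : ℚ) : ℝ) ^ 2 := by
    rw [if_neg (by decide)]
    exact_mod_cast hmB
  have hmE' : ((bx.bE.Hhi : ℚ) : ℝ) < (if D4Irrep.E = D4Irrep.E then 3 else 2) * ((bx.bE.rhohi : ℚ) : ℝ) ^ 2 := by
    rw [if_pos rfl]
    exact_mod_cast hmE
  have hBN_B := (stub_klBlockNodeR μ hμ' bx.bB1g tab D4Irrep.B1g _ htB hwB (by decide) hEB hR2' hrow hmB' g hg hgv).1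
    (by decide)
  have hBN_E := (stub_klBlockNodeR μ hμ' bx.bE tab D4Irrep.E _ htE hwE (by decide) hEE hR2' hrow hmE' f hf hfv).2 rfl
  have hr1B' : (0 : ℝ) ≤ ((bx.r1B : ℚ) : ℝ) := by exact_mod_cast hr1B
  have hr1Be' : ((bx.R2 : ℚ) : ℝ) * ((bx.bB1g.katoR : ℚ) : ℝ) ≤ ((bx.r1B : ℚ) : ℝ) ^ 2 := by exact_mod_cast hr1Be
  have hr2B' : (0 : ℝ) ≤ ((bx.r2B : ℚ) : ℝ) := by exact_mod_cast hr2B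
  have hr2Bp' : ((bx.r2B : ℚ) : ℝ) ^ 2 * ((bx.bB1g.Nhi : ℚ) : ℝ) ≤ ((bx.pB : ℚ) : ℝ) := by exact_mod_cast hr2Bp
  have hr12B' : ((bx.r1B : ℚ) : ℝ) < ((bx.r2B : ℚ) : ℝ) := by exact_mod_cast hr12B
  have hcB' : ((cov : ℚ) : ℝ) * ((bx.bB1g.lowerR tab D4Irrep.B1g : ℚ) : ℝ) ^ 2 ≤
      (((bx.r2B : ℚ) : ℝ) - ((bx.r1B : ℚ) : ℝ)) ^ 2 := by exact_mod_cast hcB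
  have hr1E' : (0 : ℝ) ≤ ((bx.r1E : ℚ) : ℝ) := by exact_mod_cast hr1E
  have hr1Ee' : ((bx.R2 : ℚ) : ℝ) * ((bx.bE.katoR : ℚ) : ℝ) ≤ ((bx.r1E : ℚ) : ℝ) ^ 2 := by exact_mod_cast hr1Ee
  have hr2E' : (0 : ℝ) ≤ ((bx.r2E : ℚ) : ℝ) := by exact_mod_cast hr2E
  have hr2Ep' : ((bx.r2E : ℚ) : ℝ) ^ 2 * ((bx.bE.Nhi : ℚ) : ℝ) ≤ ((bx.pE : ℚ) : ℝ) := by exact_mod_cast hr2Ep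
  have hr12E' : ((bx.r1E : ℚ) : ℝ) < ((bx.r2E : ℚ) : ℝ) := by exact_mod_cast hr12E
  have hcE' : ((cov : ℚ) : ℝ) * ((bx.bE.lowerR tab D4Irrep.E : ℚ) : ℝ) ^ 2 ≤
      (((bx.r2E : ℚ) : ℝ) - ((bx.r1E : ℚ) : ℝ)) ^ 2 := by exact_mod_cast hcE
  filter_upwards [hF, hBN_B, hBN_E] with k hk hBk hEk
  obtain ⟨-, hdisj⟩ := hN k hk
  have hsum_nonneg : 0 ≤ f k ^ 2 + f (rotMomentum k) ^ 2 := by positivity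
  have hs : Real.sqrt (f k ^ 2 + f (rotMomentum k) ^ 2) ^ 2 = f k ^ 2 + f (rotMomentum k) ^ 2 :=
    Real.sq_sqrt hsum_nonneg
  rcases hdisj with h1 | h2 | h3
  · -- the `B1g` amplitude clears its threshold: `cov ≤ g(k)²`
    have hc := klc_node_arith h1 hBk (abs_nonneg _) hNB hNhiB hR2' hr1B' hr1Be' hr2B' hr2Bp' hr12B' hcB'
    rw [sq_abs] at hc
    linarith
  · -- the `E_x` amplitude clears its threshold: `cov ≤ f(k)² + f(rot k)²`
    have hc := klc_node_arith h2 hEk.1 (Real.sqrt_nonneg _) hNE hNhiE hR2' hr1E' hr1Ee' hr2E' hr2Ep' hr12E' hcE'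
    rw [hs] at hc
    nlinarith [sq_nonneg (g k)]
  · -- the `E_y` amplitude (the rotated trial) clears its threshold
    rw [klc_rot3_bridge hμ'] at h3
    have hc := klc_node_arith h3 hEk.2 (Real.sqrt_nonneg _) hNE hNhiE hR2' hr1E' hr1Ee' hr2E' hr2Ep' hr12E' hcE'
    rw [hs] at hc
    nlinarith [sq_nonneg (g k)]

/-- **Soundness of the certificate** (`stub_klCertNumerical`): if the checker accepts the record `c` and its enclosures
hold, then the `μ`-form numerical clauses hold on `[c.mub, c.mua]` with margin `c.gamma` and node-covering constant
`c.cov`: (N0) fillings, (N1) `B1g` leads at `μ_a`, (N2) `E` leads at `μ_b`, (N3) two-channel isolation, (N4) negativity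
of the `B1g`/`E` bottoms, (N5) node covering by every `B1g` bottom state and every `E` bottom state with its rotate.
[folklore] -/
theorem stub_klCertNumericalR : ∀ c : KLCert, c.checkR = true → c.EnclosuresR →
    ((-4 : ℝ) < ((c.mub : ℚ) : ℝ) ∧ ((c.mub : ℚ) : ℝ) < ((c.mua : ℚ) : ℝ) ∧ ((c.mua : ℚ) : ℝ) < 0 ∧
      (0 : ℝ) < ((c.gamma : ℚ) : ℝ) ∧ (0 : ℝ) < ((c.cov : ℚ) : ℝ)) ∧
    (3 / 10 : ℝ) ≤ 1 - KohnLuttinger.filling (squareDispersion 1 0) ((c.mua : ℚ) : ℝ) ∧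
    1 - KohnLuttinger.filling (squareDispersion 1 0) ((c.mub : ℚ) : ℝ) ≤ (12 / 25 : ℝ) ∧
    (∀ χ, χ ≠ D4Irrep.B1g →
      channelInf (squareDispersion 1 0) ((c.mua : ℚ) : ℝ) 1 D4Irrep.B1g + ((c.gamma : ℚ) : ℝ) ≤
        channelInf (squareDispersion 1 0) ((c.mua : ℚ) : ℝ) 1 χ) ∧
    (∀ χ, χ ≠ D4Irrep.E →
      channelInf (squareDispersion 1 0) ((c.mub : ℚ) : ℝ) 1 D4Irrep.E + ((c.gamma : ℚ) : ℝ) ≤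
        channelInf (squareDispersion 1 0) ((c.mub : ℚ) : ℝ) 1 χ) ∧
    (∀ μ ∈ Set.Icc ((c.mub : ℚ) : ℝ) ((c.mua : ℚ) : ℝ), ∀ χ, χ ≠ D4Irrep.B1g → χ ≠ D4Irrep.E →
      min (channelInf (squareDispersion 1 0) μ 1 D4Irrep.B1g) (channelInf (squareDispersion 1 0) μ 1 D4Irrep.E)
          + ((c.gamma : ℚ) : ℝ) ≤
        channelInf (squareDispersion 1 0) μ 1 χ) ∧
    (∀ μ ∈ Set.Icc ((c.mub : ℚ) : ℝ) ((c.mua : ℚ) : ℝ),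
      channelInf (squareDispersion 1 0) μ 1 D4Irrep.B1g < 0 ∧ channelInf (squareDispersion 1 0) μ 1 D4Irrep.E < 0) ∧
    (∀ μ ∈ Set.Icc ((c.mub : ℚ) : ℝ) ((c.mua : ℚ) : ℝ), ∀ g f : Momentum → ℝ,
      IsChannelState (squareDispersion 1 0) μ D4Irrep.B1g g →
      pairingForm (squareDispersion 1 0) μ 1 g = channelInf (squareDispersion 1 0) μ 1 D4Irrep.B1g →
      IsChannelState (squareDispersion 1 0) μ D4Irrep.E f →
      pairingForm (squareDispersion 1 0) μ 1 f = channelInf (squareDispersion 1 0) μ 1 D4Irrep.E →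
      ∀ᵐ k ∂fermiCurveMeasure (squareDispersion 1 0) μ,
        ((c.cov : ℚ) : ℝ) ≤ g k ^ 2 + (f k ^ 2 + f (rotMomentum k) ^ 2)) := by
  intro c hc hEnc
  obtain ⟨⟨h4, hba, ha0, hγ, hcov⟩, hboxes, hcover, ⟨bxa, hbxa, ha1, ha2, hlead1⟩, ⟨bxb, hbxb, hb1, hb2, hlead2⟩⟩ :=
    stub_klCoverLogicR c hc
  obtain ⟨hfa, hfb, hEbox⟩ := hEnc
  have hbox : ∀ μ ∈ Set.Icc ((c.mub : ℚ) : ℝ) ((c.mua : ℚ) : ℝ), ∃ bx ∈ c.boxes,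
      μ ∈ Set.Icc ((bx.mulo : ℚ) : ℝ) ((bx.muhi : ℚ) : ℝ) := by
    intro μ hμ
    exact hcover μ hμ.1 hμ.2
  refine ⟨⟨by exact_mod_cast h4, by exact_mod_cast hba, by exact_mod_cast ha0, by exact_mod_cast hγ,
    by exact_mod_cast hcov⟩, by linarith, by linarith, ?_, ?_, ?_, ?_, ?_⟩
  · -- N1: `B1g` leads at `μ_a`
    intro χ hχ
    have hμa : ((c.mua : ℚ) : ℝ) ∈ Set.Icc ((bxa.mulo : ℚ) : ℝ) ((bxa.muhi : ℚ) : ℝ) :=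
      ⟨by exact_mod_cast ha1, by exact_mod_cast ha2⟩
    obtain ⟨hbB, -, hbN⟩ := hboxes bxa hbxa
    obtain ⟨hEa, -⟩ := hEbox bxa hbxa _ hμa
    obtain ⟨-, hlow, hupB, -⟩ := klcr_box_bounds bxa c.trials hbB hbN hμa hEa
    have hl : bxa.bB1g.upper + c.gamma ≤ bxa.bA1g.lowerR c.trials .A1g ∧
        bxa.bB1g.upper + c.gamma ≤ bxa.bA2g.lowerR c.trials .A2g ∧
        bxa.bB1g.upper + c.gamma ≤ bxa.bB2g.lowerR c.trials .B2g ∧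
        bxa.bB1g.upper + c.gamma ≤ bxa.bE.lowerR c.trials .E := by
      simpa only [KLBox.b1gLeadsOKR, Bool.and_eq_true, decide_eq_true_eq, and_assoc] using hlead1
    obtain ⟨hA1, hA2, hB2, hEE⟩ := hl
    cases χ with
    | A1g =>
      calc channelInf (squareDispersion 1 0) ((c.mua : ℚ) : ℝ) 1 D4Irrep.B1g + ((c.gamma : ℚ) : ℝ)
          ≤ ((bxa.bB1g.upper : ℚ) : ℝ) + ((c.gamma : ℚ) : ℝ) := add_le_add hupB le_rfl
        _ ≤ ((bxa.bA1g.lowerR c.trials .A1g : ℚ) : ℝ) := by exact_mod_cast hA1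
        _ ≤ _ := hlow D4Irrep.A1g
    | A2g =>
      calc channelInf (squareDispersion 1 0) ((c.mua : ℚ) : ℝ) 1 D4Irrep.B1g + ((c.gamma : ℚ) : ℝ)
          ≤ ((bxa.bB1g.upper : ℚ) : ℝ) + ((c.gamma : ℚ) : ℝ) := add_le_add hupB le_rfl
        _ ≤ ((bxa.bA2g.lowerR c.trials .A2g : ℚ) : ℝ) := by exact_mod_cast hA2
        _ ≤ _ := hlow D4Irrep.A2g
    | B1g => exact absurd rfl hχ
    | B2g =>
      calc channelInf (squareDispersion 1 0) ((c.mua : ℚ) : ℝ) 1 D4Irrep.B1g + ((c.gamma : ℚ) : ℝ)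
          ≤ ((bxa.bB1g.upper : ℚ) : ℝ) + ((c.gamma : ℚ) : ℝ) := add_le_add hupB le_rfl
        _ ≤ ((bxa.bB2g.lowerR c.trials .B2g : ℚ) : ℝ) := by exact_mod_cast hB2
        _ ≤ _ := hlow D4Irrep.B2g
    | E =>
      calc channelInf (squareDispersion 1 0) ((c.mua : ℚ) : ℝ) 1 D4Irrep.B1g + ((c.gamma : ℚ) : ℝ)
          ≤ ((bxa.bB1g.upper : ℚ) : ℝ) + ((c.gamma : ℚ) : ℝ) := add_le_add hupB le_rfl
        _ ≤ ((bxa.bE.lowerR c.trials .E : ℚ) : ℝ) := by exact_mod_cast hEE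
        _ ≤ _ := hlow D4Irrep.E
  · -- N2: `E` leads at `μ_b`
    intro χ hχ
    have hμb : ((c.mub : ℚ) : ℝ) ∈ Set.Icc ((bxb.mulo : ℚ) : ℝ) ((bxb.muhi : ℚ) : ℝ) :=
      ⟨by exact_mod_cast hb1, by exact_mod_cast hb2⟩
    obtain ⟨hbB, -, hbN⟩ := hboxes bxb hbxb
    obtain ⟨hEb, -⟩ := hEbox bxb hbxb _ hμb
    obtain ⟨-, hlow, -, hupE⟩ := klcr_box_bounds bxb c.trials hbB hbN hμb hEb
    have hl : bxb.bE.upper + c.gamma ≤ bxb.bA1g.lowerR c.trials .A1g ∧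
        bxb.bE.upper + c.gamma ≤ bxb.bA2g.lowerR c.trials .A2g ∧
        bxb.bE.upper + c.gamma ≤ bxb.bB2g.lowerR c.trials .B2g ∧
        bxb.bE.upper + c.gamma ≤ bxb.bB1g.lowerR c.trials .B1g := by
      simpa only [KLBox.eLeadsOKR, Bool.and_eq_true, decide_eq_true_eq, and_assoc] using hlead2
    obtain ⟨hA1, hA2, hB2, hB1⟩ := hl
    cases χ with
    | A1g =>
      calc channelInf (squareDispersion 1 0) ((c.mub : ℚ) : ℝ) 1 D4Irrep.E + ((c.gamma : ℚ) : ℝ)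
          ≤ ((bxb.bE.upper : ℚ) : ℝ) + ((c.gamma : ℚ) : ℝ) := add_le_add hupE le_rfl
        _ ≤ ((bxb.bA1g.lowerR c.trials .A1g : ℚ) : ℝ) := by exact_mod_cast hA1
        _ ≤ _ := hlow D4Irrep.A1g
    | A2g =>
      calc channelInf (squareDispersion 1 0) ((c.mub : ℚ) : ℝ) 1 D4Irrep.E + ((c.gamma : ℚ) : ℝ)
          ≤ ((bxb.bE.upper : ℚ) : ℝ) + ((c.gamma : ℚ) : ℝ) := add_le_add hupE le_rfl
        _ ≤ ((bxb.bA2g.lowerR c.trials .A2g : ℚ) : ℝ) := by exact_mod_cast hA2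
        _ ≤ _ := hlow D4Irrep.A2g
    | B1g =>
      calc channelInf (squareDispersion 1 0) ((c.mub : ℚ) : ℝ) 1 D4Irrep.E + ((c.gamma : ℚ) : ℝ)
          ≤ ((bxb.bE.upper : ℚ) : ℝ) + ((c.gamma : ℚ) : ℝ) := add_le_add hupE le_rfl
        _ ≤ ((bxb.bB1g.lowerR c.trials .B1g : ℚ) : ℝ) := by exact_mod_cast hB1
        _ ≤ _ := hlow D4Irrep.B1g
    | B2g =>
      calc channelInf (squareDispersion 1 0) ((c.mub : ℚ) : ℝ) 1 D4Irrep.E + ((c.gamma : ℚ) : ℝ)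
          ≤ ((bxb.bE.upper : ℚ) : ℝ) + ((c.gamma : ℚ) : ℝ) := add_le_add hupE le_rfl
        _ ≤ ((bxb.bB2g.lowerR c.trials .B2g : ℚ) : ℝ) := by exact_mod_cast hB2
        _ ≤ _ := hlow D4Irrep.B2g
    | E => exact absurd rfl hχ
  · -- N3: two-channel isolation on the window
    intro μ hμ χ hχB hχE
    obtain ⟨bx, hbx, hμbx⟩ := hbox μ hμ
    obtain ⟨hbB, hbI, hbN⟩ := hboxes bx hbx
    obtain ⟨hEμ, -⟩ := hEbox bx hbx μ hμbx
    obtain ⟨-, hlow, hupB, hupE⟩ := klcr_box_bounds bx c.trials hbB hbN hμbx hEμ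
    have hl : bx.bB1g.upper < 0 ∧ bx.bE.upper < 0 ∧
        min bx.bB1g.upper bx.bE.upper + c.gamma ≤ bx.bA1g.lowerR c.trials .A1g ∧
        min bx.bB1g.upper bx.bE.upper + c.gamma ≤ bx.bA2g.lowerR c.trials .A2g ∧
        min bx.bB1g.upper bx.bE.upper + c.gamma ≤ bx.bB2g.lowerR c.trials .B2g := by
      simpa only [KLBox.isolationOKR, Bool.and_eq_true, decide_eq_true_eq, and_assoc] using hbI
    obtain ⟨-, -, hA1, hA2, hB2⟩ := hl
    have hmin : min (channelInf (squareDispersion 1 0) μ 1 D4Irrep.B1g) (channelInf (squareDispersion 1 0) μ 1 D4Irrep.E)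
        ≤ min ((bx.bB1g.upper : ℚ) : ℝ) ((bx.bE.upper : ℚ) : ℝ) := min_le_min hupB hupE
    cases χ with
    | A1g =>
      calc min (channelInf (squareDispersion 1 0) μ 1 D4Irrep.B1g) (channelInf (squareDispersion 1 0) μ 1 D4Irrep.E)
            + ((c.gamma : ℚ) : ℝ)
          ≤ min ((bx.bB1g.upper : ℚ) : ℝ) ((bx.bE.upper : ℚ) : ℝ) + ((c.gamma : ℚ) : ℝ) := add_le_add hmin le_rfl
        _ ≤ ((bx.bA1g.lowerR c.trials .A1g : ℚ) : ℝ) := by exact_mod_cast hA1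
        _ ≤ _ := hlow D4Irrep.A1g
    | A2g =>
      calc min (channelInf (squareDispersion 1 0) μ 1 D4Irrep.B1g) (channelInf (squareDispersion 1 0) μ 1 D4Irrep.E)
            + ((c.gamma : ℚ) : ℝ)
          ≤ min ((bx.bB1g.upper : ℚ) : ℝ) ((bx.bE.upper : ℚ) : ℝ) + ((c.gamma : ℚ) : ℝ) := add_le_add hmin le_rfl
        _ ≤ ((bx.bA2g.lowerR c.trials .A2g : ℚ) : ℝ) := by exact_mod_cast hA2
        _ ≤ _ := hlow D4Irrep.A2g
    | B1g => exact absurd rfl hχB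
    | B2g =>
      calc min (channelInf (squareDispersion 1 0) μ 1 D4Irrep.B1g) (channelInf (squareDispersion 1 0) μ 1 D4Irrep.E)
            + ((c.gamma : ℚ) : ℝ)
          ≤ min ((bx.bB1g.upper : ℚ) : ℝ) ((bx.bE.upper : ℚ) : ℝ) + ((c.gamma : ℚ) : ℝ) := add_le_add hmin le_rfl
        _ ≤ ((bx.bB2g.lowerR c.trials .B2g : ℚ) : ℝ) := by exact_mod_cast hB2
        _ ≤ _ := hlow D4Irrep.B2g
    | E => exact absurd rfl hχE
  · -- N4: negativity of the two leading bottoms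
    intro μ hμ
    obtain ⟨bx, hbx, hμbx⟩ := hbox μ hμ
    obtain ⟨hbB, hbI, hbN⟩ := hboxes bx hbx
    obtain ⟨hEμ, -⟩ := hEbox bx hbx μ hμbx
    obtain ⟨-, -, hupB, hupE⟩ := klcr_box_bounds bx c.trials hbB hbN hμbx hEμ
    have hl : bx.bB1g.upper < 0 ∧ bx.bE.upper < 0 ∧
        min bx.bB1g.upper bx.bE.upper + c.gamma ≤ bx.bA1g.lowerR c.trials .A1g ∧
        min bx.bB1g.upper bx.bE.upper + c.gamma ≤ bx.bA2g.lowerR c.trials .A2g ∧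
        min bx.bB1g.upper bx.bE.upper + c.gamma ≤ bx.bB2g.lowerR c.trials .B2g := by
      simpa only [KLBox.isolationOKR, Bool.and_eq_true, decide_eq_true_eq, and_assoc] using hbI
    obtain ⟨hUB, hUE, -⟩ := hl
    exact ⟨hupB.trans_lt (by exact_mod_cast hUB), hupE.trans_lt (by exact_mod_cast hUE)⟩
  · -- N5: node covering
    intro μ hμ g f hg hgv hf hfv
    obtain ⟨bx, hbx, hμbx⟩ := hbox μ hμ
    obtain ⟨hbB, -, hbN⟩ := hboxes bx hbx
    obtain ⟨hEμ, hNμ⟩ := hEbox bx hbx μ hμbx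
    exact klcr_box_node bx c.trials hbB hbN hμbx hEμ hNμ g f hg hgv hf hfv

end Summit.HubbardSuperconductivity.HubbardSuperconductivity.Theorems

end
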